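import Literature.AlgebraicGeometry.HodgeTheory.SymmetricA3EquivariantSlice
import Literature.Analysis.Complex.SmoothHypersurfaceDivision
import HarnessLib

/-!
# The symmetric `A₃` point: the reduced chart of the two-parameter unfolding `f₁ + α g₂ + β g₀`
# (programme B2-BIF, stage S2b, for the binder hB2 `picardLefschetz_symmetricA3` of crux K1-B)

Family `hodge`, layer `Literature/AlgebraicGeometry/HodgeTheory`, sequel of `SymmetricA3EquivariantSlice` (S2a) and
`SymmetricA3SliceReduction` (S0–S1).  Written by the prover seat `hodge-nonav-prover-Bx` (g12, cell `hodge-nonav`),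
programme memo `HOME/memos/PROGRAMME-B2BIF-Bx-g12.md`.

Restricting the equivariant slice chart `IsSymmetricA3Datum.exists_equivariantSliceChart` (universal coefficients) to
the two-parameter family `F_μ = f₁ + α g₂ + β g₀`, `μ = (α, β)`, gives the REDUCED CHART of AGZV II §5.2 in the
parameters `p = (μ, u) ∈ (ℂ × ℂ) × ℂ` (`u = x_k` the kernel coordinate of the Hessian at the `A₃` point `e_j`):

* `IsSymmetricA3Datum.exists_reducedChart` — an open `D ∋ 0`, the slice-critical point `x(p)` (analytic on `D`,
  `x(0) = e_j`, `x_j = 1`, `x_k = u`, `∂ᵢF_μ(x(p)) = 0` for `i ∉ {j, k}`), EQUIVARIANCE (`D` is stable under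
  `u ↦ −u` and `x(μ, −u)` is the reflection `a_j • (a • x(μ, u))`), the DIVISION `∂ₖF_μ(x(p)) = u · s(p)` with `s`
  holomorphic and even in `u` (the `∂ₖ`-partial is odd by the reflection chain rule, and Hadamard division
  `SCV.exists_eq_smul_of_eqOn_zero` by the coordinate `u`), the GRADIENT of the reduced function
  `r(p) = F_μ(x(p))`: `dr = g₂(x) dα + g₀(x) dβ + u s du` (chain rule through the joint form: the `x`-partials
  `i ∉ {j,k}` vanish at `x(p)`, `x_j ≡ 1`, `x_k ≡ u`, and `∂F/∂a_m = x^m`), and UNIQUENESS: every point `x` near `e_j`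
  with `x_j = 1` at which the partials `i ∉ {j, k}` of a member `F_μ` (`μ` near `0`) vanish is `x(μ, x_k)`.

The critical points of `F_μ` on the slice near `e_j` are thus `{u = 0} ∪ {s(μ, u) = 0}` (axis and off-axis
branches), the starting point of the bifurcation analysis (stages S3–S7).

## References
* [ArnoldGuseinzadeVarchenko2012] AGZV II, Part I §5.2 (boundary singularities `B_k`, pp. 129–133): reduction to the
  kernel line, `ℤ/2`-equivariance, the level bifurcation set of `B₂`.
* [VoisinHodgeII2003] Voisin II, §2.1.1 Lemma 2.7, Cor. 2.8 (the chart and the derivative of the branch function).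
-/

noncomputable section

open MvPolynomial
open _root_.Topology _root_.Filter Set
open Literature.AlgebraicGeometry.Motives Literature.AlgebraicGeometry.Motives.UniversalHypersurface
open Literature.NumberTheory.Transcendental (hasFDerivAt_eval)

namespace Literature.AlgebraicGeometry.HodgeTheory

section HodgeTheory

variable {n d : ℕ} {f₁ g₀ g₂ : MvPolynomial (Fin (n + 2)) ℂ} {j k : Fin (n + 2)} {a : Fin (n + 2) → ℂˣ}

namespace IsSymmetricA3Datum

open DiscriminantBranches

/-- The coefficient vector of a member of the family is affine in the parameters. [folklore] -/
private theorem coeffsOf_member (f₁ g₀ g₂ : MvPolynomial (Fin (n + 2)) ℂ) (μ : ℂ × ℂ) (m : DegIndex n d) :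
    coeffsOf n d (f₁ + μ.1 • g₂ + μ.2 • g₀) m = coeff m.1 f₁ + μ.1 * coeff m.1 g₂ + μ.2 * coeff m.1 g₀ := by
  simp [coeffsOf_apply, coeff_add, coeff_smul]

/-- The parameter map `(μ, u) ↦ (u, coeffsOf F_μ)` into the free coordinates is analytic. [folklore] -/
private theorem analyticAt_paramMap (f₁ g₀ g₂ : MvPolynomial (Fin (n + 2)) ℂ) (p : (ℂ × ℂ) × ℂ) :
    AnalyticAt ℂ (fun q : (ℂ × ℂ) × ℂ =>
      (Sum.elim (fun _ : Unit => q.2) (coeffsOf n d (f₁ + q.1.1 • g₂ + q.1.2 • g₀)) : Unit ⊕ DegIndex n d → ℂ)) p := by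
  have heq : (fun q : (ℂ × ℂ) × ℂ =>
      (Sum.elim (fun _ : Unit => q.2) (coeffsOf n d (f₁ + q.1.1 • g₂ + q.1.2 • g₀)) : Unit ⊕ DegIndex n d → ℂ)) =
      fun q v => (Sum.elim (fun _ : Unit => fun q : (ℂ × ℂ) × ℂ => q.2)
        (fun m => fun q : (ℂ × ℂ) × ℂ => coeff m.1 f₁ + q.1.1 * coeff m.1 g₂ + q.1.2 * coeff m.1 g₀) v) q := by
    funext q v
    rcases v with _ | m
    · rfl
    · simp only [Sum.elim_inr]
      exact coeffsOf_member f₁ g₀ g₂ q.1 m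
  rw [heq]
  refine AnalyticAt.pi fun v => ?_
  rcases v with _ | m
  · simp only [Sum.elim_inl]
    exact analyticAt_snd
  · simp only [Sum.elim_inr]
    have h11 : AnalyticAt ℂ (fun q : (ℂ × ℂ) × ℂ => q.1.1) p := analyticAt_fst.comp analyticAt_fst
    have h12 : AnalyticAt ℂ (fun q : (ℂ × ℂ) × ℂ => q.1.2) p := analyticAt_snd.comp analyticAt_fst
    exact (analyticAt_const.add (h11.mul analyticAt_const)).add (h12.mul analyticAt_const)

/-- Extracting a coordinate of the derivative of a map from the derivative of that coordinate function. [folklore] -/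
private theorem fderiv_apply_coord {ι : Type*} [Fintype ι] {P : Type*} [NormedAddCommGroup P] [NormedSpace ℂ P]
    {Ψ : P → (ι → ℂ)} {p : P} (hΨ : DifferentiableAt ℂ Ψ p) (v : ι) {g : P → ℂ} {g' : P →L[ℂ] ℂ}
    (hg : HasFDerivAt g g' p) (heq : (fun q => Ψ q v) =ᶠ[𝓝 p] g) (q : P) : fderiv ℂ Ψ p q v = g' q := by
  have h1 : HasFDerivAt (fun q => Ψ q v)
      ((ContinuousLinearMap.proj v : (ι → ℂ) →L[ℂ] ℂ).comp (fderiv ℂ Ψ p)) p :=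
    (ContinuousLinearMap.proj v : (ι → ℂ) →L[ℂ] ℂ).hasFDerivAt.comp p hΨ.hasFDerivAt
  have h2 : HasFDerivAt (fun q => Ψ q v) g' p := hg.congr_of_eventuallyEq heq
  have := h1.unique h2
  exact congr_arg (fun L : P →L[ℂ] ℂ => L q) this

/-- `Σ_m x^m · coeff_m g = g(x)` for a form `g` of degree `d`. [cite: VoisinHodgeII2003, §2.1.1 Cor. 2.8] -/
private theorem sum_prod_pow_mul_coeff {g : MvPolynomial (Fin (n + 2)) ℂ} (hg : g.IsHomogeneous d)
    (x : Fin (n + 2) → ℂ) : ∑ m : DegIndex n d, (m.1.prod fun j e => x j ^ e) * coeff m.1 g = eval x g := by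
  have h := evalCoeffCLM_apply_eq_sum x (coeffsOf n d g)
  rw [evalCoeffCLM_apply, formOfCoeffs_coeffsOf _ _ hg] at h
  rw [h]
  rfl

/-- **The reduced chart of the symmetric two-parameter unfolding at the `A₃` point** (AGZV II §5.2, the
reduction to the kernel line with its `ℤ/2`-symmetry).  For forms `f₁, g₀, g₂` of degree `d` with
`IsSymmetricA3Datum f₁ g₀ g₂ j k a` there are an open set `D ∋ 0` of parameters `p = ((α, β), u)`, a map
`x : D → ℂⁿ⁺²` analytic on `D` and a function `s` holomorphic on `D` such that, writing `F_{αβ} = f₁ + α g₂ + β g₀`: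
`x(0) = e_j`; `x(p)_j = 1`, `x(p)_k = u`, `∂ᵢF_{αβ}(x(p)) = 0` for `i ∉ {j, k}`; `D` is stable under `u ↦ −u` and
`x(αβ, −u) = a_j • (a • x(αβ, u))`; `∂ₖF_{αβ}(x(p)) = u · s(p)` and `s(αβ, −u) = s(αβ, u)`; the reduced function
`r(p) = F_{αβ}(x(p))` has derivative `g₂(x(p)) dα + g₀(x(p)) dβ + u s(p) du`; and for some `ρ > 0`, every `x` with
`‖x − e_j‖ < ρ`, `x_j = 1` and `∂ᵢF_{αβ}(x) = 0 (i ∉ {j, k})` for `‖(α, β)‖ < ρ` has `((α, β), x_k) ∈ D` and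
`x = x((α, β), x_k)`. [cite: ArnoldGuseinzadeVarchenko2012, Part I §5.2] [cite: VoisinHodgeII2003, §2.1.1 Lemma 2.7] -/
theorem exists_reducedChart (hf₁ : f₁.IsHomogeneous d) (hg₀ : g₀.IsHomogeneous d) (hg₂ : g₂.IsHomogeneous d)
    (hD : IsSymmetricA3Datum f₁ g₀ g₂ j k a) :
    ∃ (D : Set ((ℂ × ℂ) × ℂ)) (xs : (ℂ × ℂ) × ℂ → (Fin (n + 2) → ℂ)) (s : (ℂ × ℂ) × ℂ → ℂ),
      IsOpen D ∧ (0 : (ℂ × ℂ) × ℂ) ∈ D ∧ AnalyticOnNhd ℂ xs D ∧ DifferentiableOn ℂ s D ∧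
      xs 0 = Pi.single j 1 ∧
      (∀ p ∈ D, xs p j = 1 ∧ xs p k = p.2 ∧
        ∀ i, i ≠ j → i ≠ k → eval (xs p) (pderiv i (f₁ + p.1.1 • g₂ + p.1.2 • g₀)) = 0) ∧
      (∀ p ∈ D, (p.1, -p.2) ∈ D ∧ xs (p.1, -p.2) = (a j : ℂ) • (a • xs p)) ∧
      (∀ p ∈ D, eval (xs p) (pderiv k (f₁ + p.1.1 • g₂ + p.1.2 • g₀)) = p.2 * s p) ∧
      (∀ p ∈ D, s (p.1, -p.2) = s p) ∧
      (∀ p ∈ D, HasFDerivAt (fun q : (ℂ × ℂ) × ℂ => eval (xs q) (f₁ + q.1.1 • g₂ + q.1.2 • g₀))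
        (eval (xs p) g₂ • (ContinuousLinearMap.fst ℂ ℂ ℂ).comp (ContinuousLinearMap.fst ℂ (ℂ × ℂ) ℂ) +
          eval (xs p) g₀ • (ContinuousLinearMap.snd ℂ ℂ ℂ).comp (ContinuousLinearMap.fst ℂ (ℂ × ℂ) ℂ) +
          (p.2 * s p) • ContinuousLinearMap.snd ℂ (ℂ × ℂ) ℂ) p) ∧
      (∃ ρ : ℝ, 0 < ρ ∧ ∀ (μ : ℂ × ℂ) (x : Fin (n + 2) → ℂ), ‖μ‖ < ρ → ‖x - Pi.single j 1‖ < ρ → x j = 1 →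
        (∀ i, i ≠ j → i ≠ k → eval x (pderiv i (f₁ + μ.1 • g₂ + μ.2 • g₀)) = 0) →
        (μ, x k) ∈ D ∧ xs (μ, x k) = x) := by
  classical
  obtain ⟨T, Ω, ψ, hT, hΩ, hz₀, hψ, hw₀, hψw₀, hgraph, huniq, -, hequi⟩ := hD.exists_equivariantSliceChart hf₁ hg₀
  -- the members, their homogeneity, coefficient vectors and symmetry
  have hFhom : ∀ μ : ℂ × ℂ, (f₁ + μ.1 • g₂ + μ.2 • g₀).IsHomogeneous d := fun μ =>
    isHomogeneous_add_smul (isHomogeneous_add_smul hf₁ hg₂ _) hg₀ _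
  have hform : ∀ μ : ℂ × ℂ, formOfCoeffs (coeffsOf n d (f₁ + μ.1 • g₂ + μ.2 • g₀)) = f₁ + μ.1 • g₂ + μ.2 • g₀ :=
    fun μ => formOfCoeffs_coeffsOf _ _ (hFhom μ)
  have hsymm : ∀ μ : ℂ × ℂ, a ∈ diagonalStabilizer (formOfCoeffs (coeffsOf n d (f₁ + μ.1 • g₂ + μ.2 • g₀))) :=
    fun μ => by rw [hform]; exact hD.mem_diagonalStabilizer_member μ.1 μ.2
  -- the parameter map into the free coordinates (kept opaque)
  obtain ⟨wm, hwm⟩ : ∃ wm : (ℂ × ℂ) × ℂ → (Unit ⊕ DegIndex n d → ℂ),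
      ∀ q, wm q = Sum.elim (fun _ : Unit => q.2) (coeffsOf n d (f₁ + q.1.1 • g₂ + q.1.2 • g₀)) := ⟨_, fun q => rfl⟩
  have hwm_inl : ∀ q, wm q (Sum.inl ()) = q.2 := fun q => by rw [hwm]; rfl
  have hwm_inr : ∀ q, (fun m => wm q (Sum.inr m)) = coeffsOf n d (f₁ + q.1.1 • g₂ + q.1.2 • g₀) :=
    fun q => by rw [hwm]; rfl
  have hwmA : ∀ q, AnalyticAt ℂ wm q := by
    intro q
    have : wm = fun q => Sum.elim (fun _ : Unit => q.2) (coeffsOf n d (f₁ + q.1.1 • g₂ + q.1.2 • g₀)) := funext hwm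
    rw [this]
    exact analyticAt_paramMap f₁ g₀ g₂ q
  have hwm0 : wm 0 = Sum.elim (fun _ : Unit => (0 : ℂ)) (coeffsOf n d f₁) := by
    rw [hwm]; simp
  have hwm_neg : ∀ q, Sum.elim (fun _ : Unit => -wm q (Sum.inl ())) (fun m => wm q (Sum.inr m)) = wm (q.1, -q.2) := by
    intro q
    rw [hwm_inl, hwm_inr, hwm]
  -- the domain
  obtain ⟨D, hDdef⟩ : ∃ D : Set ((ℂ × ℂ) × ℂ), D = wm ⁻¹' T := ⟨_, rfl⟩
  have hDo : IsOpen D := by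
    rw [hDdef]; exact hT.preimage (continuous_iff_continuousAt.2 fun q => (hwmA q).continuousAt)
  have hDT : ∀ q ∈ D, wm q ∈ T := fun q hq => by rw [hDdef] at hq; exact hq
  have h0D : (0 : (ℂ × ℂ) × ℂ) ∈ D := by rw [hDdef, mem_preimage, hwm0]; exact hw₀
  -- the chart along the family and the slice-critical point
  have hΨA : AnalyticOnNhd ℂ (fun q => ψ (wm q)) D := fun q hq => (hψ _ (hDT q hq)).comp (hwmA q)
  obtain ⟨xs, hxs⟩ : ∃ xs : (ℂ × ℂ) × ℂ → (Fin (n + 2) → ℂ), ∀ q, xs q = prX n d (ψ (wm q)) :=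
    ⟨_, fun q => rfl⟩
  have hxsA : AnalyticOnNhd ℂ xs D := by
    have : xs = fun q => prX n d (ψ (wm q)) := funext hxs
    rw [this]
    exact fun q hq => ((prX n d).analyticAt _).comp (hΨA q hq)
  have hG : ∀ q ∈ D, ψ (wm q) ∈ Ω ∧ prA n d (ψ (wm q)) = coeffsOf n d (f₁ + q.1.1 • g₂ + q.1.2 • g₀) ∧
      xs q k = q.2 ∧ xs q j = 1 ∧
      ∀ i, i ≠ j → i ≠ k → eval (xs q) (pderiv i (f₁ + q.1.1 • g₂ + q.1.2 • g₀)) = 0 := by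
    intro q hq
    obtain ⟨hΩq, hA, hk, hj, hpart⟩ := hgraph (wm q) (hDT q hq)
    rw [hwm_inr] at hA
    rw [hwm_inl] at hk
    refine ⟨hΩq, hA, by rw [hxs]; exact hk, by rw [hxs]; exact hj, fun i hij hik => ?_⟩
    have := hpart i hij hik
    rw [hA, hform] at this
    rw [hxs]; exact this
  have hΨeq : ∀ q ∈ D, ψ (wm q) = Sum.elim (xs q) (coeffsOf n d (f₁ + q.1.1 • g₂ + q.1.2 • g₀)) := by
    intro q hq
    rw [hxs, ← (hG q hq).2.1, sumElim_prX_prA]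
  have hxs0 : xs 0 = Pi.single j 1 := by
    rw [hxs, hwm0, hψw₀]; rfl
  -- equivariance
  have hE : ∀ q ∈ D, (q.1, -q.2) ∈ D ∧ xs (q.1, -q.2) = (a j : ℂ) • (a • xs q) := by
    intro q hq
    have hs : a ∈ diagonalStabilizer (formOfCoeffs fun m => wm q (Sum.inr m)) := by
      rw [hwm_inr]; exact hsymm q.1
    obtain ⟨hT', hψ'⟩ := hequi (wm q) (hDT q hq) hs
    rw [hwm_neg] at hT' hψ'
    refine ⟨by rw [hDdef]; exact hT', ?_⟩
    rw [hxs, hψ', ← hxs]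
    rfl
  -- the `k`-th partial along the slice: analytic, odd in `u`, hence zero on `u = 0`
  have hh : ∀ q ∈ D, eval (ψ (wm q)) (pderiv (Sum.inl k) (jointForm n d)) =
      eval (xs q) (pderiv k (f₁ + q.1.1 • g₂ + q.1.2 • g₀)) := by
    intro q hq
    rw [hΨeq q hq, eval_pderiv_inl_jointForm, hform]
  have hhA : DifferentiableOn ℂ (fun q => eval (ψ (wm q)) (pderiv (Sum.inl k) (jointForm n d))) D :=
    ((AnalyticOnNhd.eval_mvPolynomial _).comp hΨA (mapsTo_univ _ _)).differentiableOn
  have hodd : ∀ q ∈ D, eval (xs (q.1, -q.2)) (pderiv k (f₁ + q.1.1 • g₂ + q.1.2 • g₀)) =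
      -eval (xs q) (pderiv k (f₁ + q.1.1 • g₂ + q.1.2 • g₀)) := by
    intro q hq
    rw [(hE q hq).2, hD.eval_pderiv_k_reflect hf₁ hg₀ (hFhom q.1) (hD.mem_diagonalStabilizer_member _ _)]
  have hzero : ∀ q ∈ D, (fun q : (ℂ × ℂ) × ℂ => q.2) q = 0 →
      eval (ψ (wm q)) (pderiv (Sum.inl k) (jointForm n d)) = 0 := by
    intro q hq h0
    rw [hh q hq]
    have h1 := hodd q hq
    have hq' : (q.1, -q.2) = q := Prod.ext rfl (by change -q.2 = q.2; rw [show q.2 = 0 from h0, neg_zero])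
    rw [hq'] at h1
    have h2 : (2 : ℂ) * eval (xs q) (pderiv k (f₁ + q.1.1 • g₂ + q.1.2 • g₀)) = 0 := by linear_combination h1
    exact (mul_eq_zero.1 h2).resolve_left two_ne_zero
  -- Hadamard division by `u`
  have htd : DifferentiableOn ℂ (fun q : (ℂ × ℂ) × ℂ => q.2) D := differentiableOn_snd
  have hdt : ∀ q ∈ D, (fun q : (ℂ × ℂ) × ℂ => q.2) q = 0 → fderiv ℂ (fun q : (ℂ × ℂ) × ℂ => q.2) q ≠ 0 := by
    intro q _ _ hzero'
    have h1 : fderiv ℂ (fun q : (ℂ × ℂ) × ℂ => q.2) q = ContinuousLinearMap.snd ℂ (ℂ × ℂ) ℂ :=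
      (ContinuousLinearMap.snd ℂ (ℂ × ℂ) ℂ).hasFDerivAt.fderiv
    have := congr_arg (fun L : (ℂ × ℂ) × ℂ →L[ℂ] ℂ => L ((0, 0), 1)) (h1.symm.trans hzero')
    simp at this
  obtain ⟨s, hsd, hs⟩ := Literature.Analysis.Complex.SCV.exists_eq_smul_of_eqOn_zero hDo htd hhA hdt hzero
  have hdiv : ∀ q ∈ D, eval (xs q) (pderiv k (f₁ + q.1.1 • g₂ + q.1.2 • g₀)) = q.2 * s q := by
    intro q hq
    rw [← hh q hq, hs q hq, smul_eq_mul]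
  have hseven : ∀ q ∈ D, s (q.1, -q.2) = s q := by
    intro q hq
    by_cases h0 : q.2 = 0
    · have : (q.1, -q.2) = q := Prod.ext rfl (by change -q.2 = q.2; rw [h0, neg_zero])
      rw [this]
    · have h1 := hodd q hq
      have h2 := hdiv _ (hE q hq).1
      change eval (xs (q.1, -q.2)) (pderiv k (f₁ + q.1.1 • g₂ + q.1.2 • g₀)) = -q.2 * s (q.1, -q.2) at h2
      rw [h2, hdiv q hq] at h1
      have h3 : q.2 * (s (q.1, -q.2) - s q) = 0 := by linear_combination -h1
      exact sub_eq_zero.1 ((mul_eq_zero.1 h3).resolve_left h0)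
  -- the gradient of the reduced function
  have hgrad : ∀ p ∈ D, HasFDerivAt (fun q : (ℂ × ℂ) × ℂ => eval (xs q) (f₁ + q.1.1 • g₂ + q.1.2 • g₀))
      (eval (xs p) g₂ • (ContinuousLinearMap.fst ℂ ℂ ℂ).comp (ContinuousLinearMap.fst ℂ (ℂ × ℂ) ℂ) +
        eval (xs p) g₀ • (ContinuousLinearMap.snd ℂ ℂ ℂ).comp (ContinuousLinearMap.fst ℂ (ℂ × ℂ) ℂ) +
        (p.2 * s p) • ContinuousLinearMap.snd ℂ (ℂ × ℂ) ℂ) p := by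
    intro p hp
    have heq : (fun q : (ℂ × ℂ) × ℂ => eval (xs q) (f₁ + q.1.1 • g₂ + q.1.2 • g₀)) =ᶠ[𝓝 p]
        fun q => eval (ψ (wm q)) (jointForm n d) := by
      filter_upwards [hDo.mem_nhds hp] with q hq
      rw [hΨeq q hq, eval_jointForm, hform]
    have hΨd : DifferentiableAt ℂ (fun q => ψ (wm q)) p := (hΨA p hp).differentiableAt
    have hev : HasFDerivAt (fun z : JVar n d → ℂ => eval z (jointForm n d))
        (∑ v, eval (ψ (wm p)) (pderiv v (jointForm n d)) •
          (ContinuousLinearMap.proj v : (JVar n d → ℂ) →L[ℂ] ℂ)) (ψ (wm p)) := hasFDerivAt_eval _ _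
    have hcomp : HasFDerivAt (fun q => eval (ψ (wm q)) (jointForm n d))
        ((∑ v, eval (ψ (wm p)) (pderiv v (jointForm n d)) •
          (ContinuousLinearMap.proj v : (JVar n d → ℂ) →L[ℂ] ℂ)).comp (fderiv ℂ (fun q => ψ (wm q)) p)) p :=
      by
        have h := HasFDerivAt.comp p hev hΨd.hasFDerivAt
        exact h
    have hr : HasFDerivAt (fun q : (ℂ × ℂ) × ℂ => eval (xs q) (f₁ + q.1.1 • g₂ + q.1.2 • g₀))
        ((∑ v, eval (ψ (wm p)) (pderiv v (jointForm n d)) •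
          (ContinuousLinearMap.proj v : (JVar n d → ℂ) →L[ℂ] ℂ)).comp (fderiv ℂ (fun q => ψ (wm q)) p)) p :=
      hcomp.congr_of_eventuallyEq heq
    refine hr.congr_fderiv ?_
    -- the coordinates of `d(ψ ∘ wm)(p)`
    have hDj : ∀ q, fderiv ℂ (fun q => ψ (wm q)) p q (Sum.inl j) = 0 := fun q => by
      have := fderiv_apply_coord hΨd (Sum.inl j) (hasFDerivAt_const (1 : ℂ) p) ?_ q
      · simpa using this
      · filter_upwards [hDo.mem_nhds hp] with q hq
        have := (hG q hq).2.2.2.1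
        rw [hxs] at this
        exact this
    have hDk : ∀ q : (ℂ × ℂ) × ℂ, fderiv ℂ (fun q => ψ (wm q)) p q (Sum.inl k) = q.2 := fun q => by
      have := fderiv_apply_coord hΨd (Sum.inl k) (ContinuousLinearMap.snd ℂ (ℂ × ℂ) ℂ).hasFDerivAt ?_ q
      · simpa using this
      · filter_upwards [hDo.mem_nhds hp] with q hq
        have := (hG q hq).2.2.1
        rw [hxs] at this
        exact this
    have hDm : ∀ (q : (ℂ × ℂ) × ℂ) (m : DegIndex n d), fderiv ℂ (fun q => ψ (wm q)) p q (Sum.inr m) =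
        q.1.1 * coeff m.1 g₂ + q.1.2 * coeff m.1 g₀ := fun q m => by
      have hg' : HasFDerivAt (fun q : (ℂ × ℂ) × ℂ => coeff m.1 f₁ + q.1.1 * coeff m.1 g₂ + q.1.2 * coeff m.1 g₀)
          ((0 : (ℂ × ℂ) × ℂ →L[ℂ] ℂ) +
            coeff m.1 g₂ • (ContinuousLinearMap.fst ℂ ℂ ℂ).comp (ContinuousLinearMap.fst ℂ (ℂ × ℂ) ℂ) +
            coeff m.1 g₀ • (ContinuousLinearMap.snd ℂ ℂ ℂ).comp (ContinuousLinearMap.fst ℂ (ℂ × ℂ) ℂ)) p :=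
        ((hasFDerivAt_const _ p).add
          (((ContinuousLinearMap.fst ℂ ℂ ℂ).comp (ContinuousLinearMap.fst ℂ (ℂ × ℂ) ℂ)).hasFDerivAt.mul_const _)).add
          (((ContinuousLinearMap.snd ℂ ℂ ℂ).comp (ContinuousLinearMap.fst ℂ (ℂ × ℂ) ℂ)).hasFDerivAt.mul_const _)
      have := fderiv_apply_coord hΨd (Sum.inr m) hg' ?_ q
      · rw [this]
        simp only [add_apply, zero_apply, smul_apply, ContinuousLinearMap.comp_apply, ContinuousLinearMap.coe_fst',
          ContinuousLinearMap.coe_snd', smul_eq_mul]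
        ring
      · filter_upwards [hDo.mem_nhds hp] with q hq
        have h1 : ψ (wm q) (Sum.inr m) = coeffsOf n d (f₁ + q.1.1 • g₂ + q.1.2 • g₀) m := congr_fun (hG q hq).2.1 m
        rw [h1]
        exact coeffsOf_member f₁ g₀ g₂ q.1 m
    -- the values of the partials of the joint form at `ψ(wm p) = (x(p), coeffsOf F_μ)`
    have hinl : ∀ i, eval (ψ (wm p)) (pderiv (Sum.inl i) (jointForm n d)) =
        eval (xs p) (pderiv i (f₁ + p.1.1 • g₂ + p.1.2 • g₀)) := fun i => by
      rw [hΨeq p hp, eval_pderiv_inl_jointForm, hform]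
    have hinr : ∀ m : DegIndex n d, eval (ψ (wm p)) (pderiv (Sum.inr m) (jointForm n d)) =
        m.1.prod fun j e => xs p j ^ e := fun m => by
      rw [hΨeq p hp, eval_pderiv_inr_jointForm]
    refine ContinuousLinearMap.ext fun q => ?_
    simp only [ContinuousLinearMap.comp_apply, FunLike.coe_sum, Finset.sum_apply, FunLike.coe_smul, Pi.smul_apply,
      smul_apply, ContinuousLinearMap.proj_apply, smul_eq_mul, Fintype.sum_sum_type, hinl, hinr, hDm, add_apply,
      ContinuousLinearMap.coe_fst', ContinuousLinearMap.coe_snd']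
    rw [Finset.sum_eq_single k (fun i _ hik => ?_) (fun h => absurd (Finset.mem_univ k) h), hDk, hdiv p hp]
    · have h2 : ∑ m : DegIndex n d, (m.1.prod fun j e => xs p j ^ e) * (q.1.1 * coeff m.1 g₂ + q.1.2 * coeff m.1 g₀) =
          q.1.1 * eval (xs p) g₂ + q.1.2 * eval (xs p) g₀ := by
        rw [← sum_prod_pow_mul_coeff hg₂ (xs p), ← sum_prod_pow_mul_coeff hg₀ (xs p), Finset.mul_sum, Finset.mul_sum,
          ← Finset.sum_add_distrib]
        exact Finset.sum_congr rfl fun m _ => by ring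
      rw [h2]
      ring
    · by_cases hij : i = j
      · rw [hij, hDj, mul_zero]
      · rw [(hG p hp).2.2.2.2 i hij hik, zero_mul]
  -- uniqueness near `e_j`
  have hU : ∃ ρ : ℝ, 0 < ρ ∧ ∀ (μ : ℂ × ℂ) (x : Fin (n + 2) → ℂ), ‖μ‖ < ρ → ‖x - Pi.single j 1‖ < ρ → x j = 1 →
      (∀ i, i ≠ j → i ≠ k → eval x (pderiv i (f₁ + μ.1 • g₂ + μ.2 • g₀)) = 0) →
      (μ, x k) ∈ D ∧ xs (μ, x k) = x := by
    have hGc : Continuous fun y : (ℂ × ℂ) × (Fin (n + 2) → ℂ) =>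
        (Sum.elim y.2 (coeffsOf n d (f₁ + y.1.1 • g₂ + y.1.2 • g₀)) : JVar n d → ℂ) := by
      refine continuous_pi fun v => ?_
      rcases v with i | m
      · simp only [Sum.elim_inl]
        fun_prop
      · simp only [Sum.elim_inr, coeffsOf_member]
        fun_prop
    obtain ⟨ρ, hρ, hball⟩ := Metric.isOpen_iff.1 (hΩ.preimage hGc) ((0 : ℂ × ℂ), Pi.single j (1 : ℂ))
      (by rw [mem_preimage]; simpa using hz₀)
    refine ⟨ρ, hρ, fun μ x hμ hx hxj hpart => ?_⟩
    have hmem : (μ, x) ∈ Metric.ball ((0 : ℂ × ℂ), (Pi.single j (1 : ℂ) : Fin (n + 2) → ℂ)) ρ := by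
      rw [Metric.mem_ball, Prod.dist_eq]
      change max (dist μ 0) (dist x (Pi.single j 1)) < ρ
      rw [max_lt_iff, dist_zero_right, dist_eq_norm]
      exact ⟨hμ, hx⟩
    have hzΩ := hball hmem
    rw [mem_preimage] at hzΩ
    have hpart' : ∀ i, i ≠ j → i ≠ k →
        eval (prX n d (Sum.elim x (coeffsOf n d (f₁ + μ.1 • g₂ + μ.2 • g₀)) : JVar n d → ℂ))
          (pderiv i (formOfCoeffs (prA n d (Sum.elim x (coeffsOf n d (f₁ + μ.1 • g₂ + μ.2 • g₀)))))) = 0 := by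
      intro i hij hik
      have hX : prX n d (Sum.elim x (coeffsOf n d (f₁ + μ.1 • g₂ + μ.2 • g₀)) : JVar n d → ℂ) = x := rfl
      have hA : prA n d (Sum.elim x (coeffsOf n d (f₁ + μ.1 • g₂ + μ.2 • g₀)) : JVar n d → ℂ) =
          coeffsOf n d (f₁ + μ.1 • g₂ + μ.2 • g₀) := rfl
      rw [hX, hA, hform]
      exact hpart i hij hik
    obtain ⟨hTz, hψz⟩ := huniq _ hzΩ hxj hpart'
    have hfree : Sum.elim (fun _ : Unit => (Sum.elim x (coeffsOf n d (f₁ + μ.1 • g₂ + μ.2 • g₀)) : JVar n d → ℂ) (Sum.inl k))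
        (fun m => (Sum.elim x (coeffsOf n d (f₁ + μ.1 • g₂ + μ.2 • g₀)) : JVar n d → ℂ) (Sum.inr m)) =
        wm (μ, x k) := by
      rw [hwm]; rfl
    rw [hfree] at hTz hψz
    refine ⟨by rw [hDdef]; exact hTz, ?_⟩
    rw [hxs, hψz]
    rfl
  exact ⟨D, xs, s, hDo, h0D, hxsA, hsd, hxs0,
    fun q hq => ⟨(hG q hq).2.2.2.1, (hG q hq).2.2.1, (hG q hq).2.2.2.2⟩, hE, hdiv, hseven, hgrad, hU⟩

end IsSymmetricA3Datum

end HodgeTheory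

end Literature.AlgebraicGeometry.HodgeTheory

end
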